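/- Copyright: the b2b-balaban cell (near-miss cell 7), T⁴-continuum fan-out, lineage t4-ne7b-formalise-leaf-06 (NE7b CRUX
TEAM (2) leaf prover 06), gen 36: IR-51-1 part 1∕2 «THE SHRUNK VOLUME DISPLAYS AT ANY COLLAR» (supply module; part 2 = `…VolumeWindowShrunk82`).
Released under the licence of the surrounding project. -/
import Summits.QuantumFields.BalabanUV.T4Continuum.Support.HistoryBankingVolumeWindowShrunk

/-!
# History banking, M5-2d∕M5-2e supplier, part 1∕2: THE SHRUNK VOLUME DISPLAYS AT ANY COLLAR `σ` AND ANY FEEDBACK CONSTANT `c`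
(`VolumeDisplaysP`), DISCHARGED AT BOTH LETTERS at any slack weight `a` — route R-P1 of row NE7b; INTERFACE REQUEST NE7b IR-51-1 of the
OWNER t4-ne7b-p1 g51 («LEAF-06's σ-PARAMETRIC OPTION IS PREFERRED … ONE set of window∕filler theorems in (σ, φ, a)»); the M5-2e instance
of record (`VolumeDisplaysS82`, `jvol82`, `ellVolS82`, weight `cvol82`) is part 2∕2 `HistoryBankingVolumeWindowShrunk82`; supply module only

Summits-side support leaf of the T⁴-continuum cell (rung (B)+1 on a FINITE torus only; NOT infinite volume, NOT the mass gap,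
NOT the Clay statement; NOT a proof of the spine estimate NE7b — the cell's OWN estimate, NOT PRINTED, NOT PROVED).  [folklore]
real arithmetic over the siblings `HistoryBankingVolumeWindow`∕`…Lattice`∕`…Shrunk` (letters `uvol`∕`uvolL`, growth `uvol_le_of_le`∕
`uvolL_le_of_le`, window-free steps `uvol(L)_mul_le_of_clause`, `coef_mul_letter(L)_le_credit`), `HistoryBankingRoundingWindow.
envelope_of_isRj`, `HistoryBankingRoundingSupply` (`le_pow_of_rpow_inv_le`, `le_ell_of_coupling`) and the typed flow displays (2.5) `B14.IsRj`, (2.7)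
`B14.FlowIneq27`, (2.9) `B14FlowStep.FlowIneq29`; no `[cite:]` tag, nothing printed asserted, no `def … : Prop`, zero `sorry`.  NO ledger
and NO constant of the OWNER's is imported here: collar `σ`, feedback constant `c` and slack weight `a` are PARAMETERS (IR-51-1's `(σ φ a)`).

WHY.  M5-2d's `shrunk_volume_le_lifeCost` (OWNER g50) and M5-2e's per-level-dead-box twin (OWNER g51, R-OWNER-51-1 (3)) consume the
SAME eight volume binders up to two numerals — the floor collar (`6·1122^d` ↦ `6·collar82 d`) and the lag clause's absorbed-feedback
constant (`1122^d·16·21^d` ↦ `feed82 d`) — and the slack display `huθS` at a new class-linear weight (`cvol82 d j Γ`).  IR-50-1 carries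
the weight as a parameter `a`; THIS FILE makes collar `σ` and constant `c` parameters too, so ONE supplier serves M5-2d (`VolumeDisplaysS`
IS the instance `σ = 6·1122^d`, `c = 1122^d·16·21^d`: `volumeDisplaysP_iff_S`), M5-2e (part 2's `VolumeDisplaysS82` = the instance
`σ = 6·collar82 d`, `c = feed82 d`, weight `cvol82 d j Γ`) and any later re-calibration of the collar, with ONE set of theorems.

WHAT.  §1 `structure VolumeDisplaysP C d K R u Γ j σ c` (DISPLAY SHAPE: `hu ∕ hΓ0 ∕ hΓ ∕ hj1`, `hsmall : c·Γ ≤ 2^j∕2`, `huS : u_t·σ ≤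
floorK C K R t`, `huE₂ ∕ huE₃`); the generic lag `jlag c Γ = max 1 ⌈log₂⌈2cΓ⌉⌉` (`one_le_jlag`, `hsmall_jlag`, `jvol_eq_jlag`).  §2 per cube
(`u := uvol cΛ g K`, `Γ := 1 + β₀`): `structure VolumeWindowP` ((WP1) `σ·cΛ ≤ E₂·ℓ^{κ₂}`, (WP2)∕(WP3), (WP4) `a·cΛ ≤ θᵥ·A₀²·ℓ^{κᵥ}`;
`1 + κ₂ = r·q′`, `1 + κᵥ = 2p₀`); `volumeDisplaysP_uvol : VolumeDisplaysP C d K R (uvol cΛ g K) (1+β₀) (jlag c (1+β₀)) σ c`, `_of_isRj`,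
`_of_log_eq`; `huθP_uvol`, `huθP_events_of_log_eq`; threshold `ellVolP`, `volumeWindowP_of_threshold` ∕ `_of_couplings`; prefix fillers
`volumeDisplaysP_of_log_eq_of_inInterval`, `huθP_events_of_log_eq_of_inInterval`.  §3 lattice units (`u := uvolL cΛ M d g R K`,
`Γ := (1+β₀)·L^d`): `structure VolumeWindowPL` ((WP1ᴸ) `σ·(cΛM^d) ≤ E₂·ℓ^{κ₂}`, (WP4ᴸ) `a·(cΛ(LM)^d) ≤ θᵥ·A₀²·ℓ^{κᵥ}`; `1 + κ₂ = r·(q′ − d)`,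
`d ≤ q′`, `1 + r·d + κᵥ = 2p₀`); `volumeDisplaysPL_uvolL`, `_of_isRj`, `_of_log_eq`; `huθPL_uvolL`, `huθPL_events_of_log_eq`; `ellVolPL`,
`volumeWindowPL_of_threshold` ∕ `_of_couplings`; `volumeDisplaysPL_of_log_eq_of_inInterval`, `huθPL_events_of_log_eq_of_inInterval`.
EVENT SHAPES: `huθP(L)_events_of_log_eq(_of_inInterval)` conclude in IR-50-1's guarded shape `∀ e ∈ E, (sh e).kind = 0 →
(sh e).step ≤ K → a·log Λ_{(sh e).step} ≤ θᵥ·p₀(g_{(sh e).step})²` (IR-51-1 (ii)); `huθP(L)_births_of_log_eq_of_inInterval` take `hsteps : ∀ e ∈ E,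
(sh e).kind = 0 → (sh e).step ≤ K` and conclude WITHOUT the guard — the witness' ∕ the L-record's `huV` shape (IR-48-2's `huV_events…`, fed
by `births_le_of_step_le`).  Part 2 instantiates everything at M5-2e's letters; the coupling bounds `e^{−ℓ∕2}` are positive by `Real.exp_pos`.

CENSUS NOTE.  Nothing is valued here; the census sentences live with the instances (IR-50-1's docstring for M5-2d's `6·1122^d`:
`5.668·10⁵·ρ` under reading (A); part 2's for M5-2e's `6·collar82 d`: `361.46·ρ`, NIL at ratio one, THIN — the OWNER's R-OWNER-51-1 desk floats,
balaban-calc «VOLUME-4» to certify).  Symbolically: (WP1ᴸ) binds at `ℓ ≥ (σ·cΛM^d∕E₂)^{1∕κ₂}`, linear in the collar at `κ₂ = 1`.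

HONEST SCOPE.  Real arithmetic over OUR carriers; both windows are HYPOTHESIS shapes (smallness of OUR letters, reducible to
`g_j ≤ γ ≤ e^{−ℓ∕2}`); `cΛ`, `M`, `a`, `σ` displayed nonnegative reals, `c` any real, never numerals (the constants of record are
named in part 2, valued nowhere); nothing of H3 ∕ (B) ∕ BetaPertH is discharged; the currency readings are the OWNER's rulings, not kernel facts.  Nothing
of Bałaban's is asserted or contested.  NE7b NOT PRINTED ∕ NOT PROVED; spine 0∕9; rung (B)+1 on a FINITE torus — NOT infinite volume, NOT
the mass gap, NOT Clay.  HONEST DEPENDENCY (cell): continuum YM on T⁴ ⇐ BetaPertH ∧ nine spine estimates (0/9 proved); BetaPertH ⇐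
(D1) ∧ (D4) ∧ CAP+tail; G-an2-4 gates asym, D1 and NE2/3/4.  This file changes none of it.
-/

open Literature.MathematicalPhysics.QuantumFieldTheory.Balaban1983to89
open T4PersistenceDictionary T4PrintedShapeBanking T4Continuum
open Summit.QuantumFields.BalabanUV.T4Continuum.HistoryConstants
open Summit.QuantumFields.BalabanUV.T4Continuum.HistoryBankingSharpShares
open Summit.QuantumFields.BalabanUV.T4Continuum.HistoryBankingRoundingWindow (envelope_of_isRj)
open Summit.QuantumFields.BalabanUV.T4Continuum.HistoryBankingRoundingSupply
open Summit.QuantumFields.BalabanUV.T4Continuum.HistoryBankingVolumeWindow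
open Summit.QuantumFields.BalabanUV.T4Continuum.HistoryBankingVolumeWindowLattice
open Summit.QuantumFields.BalabanUV.T4Continuum.HistoryBankingVolumeWindowShrunk

namespace Summit.QuantumFields.BalabanUV.T4Continuum.HistoryBankingVolumeWindowCollar

noncomputable section

/-! ## §1 The shrunk-ledger volume binders at any collar `σ` and feedback constant `c`, bundled; the generic lag -/
section Bundle

/-- **THE SHRUNK-LEDGER VOLUME BINDERS AT ANY COLLAR, BUNDLED** (DISPLAY SHAPE): M5-2d's eight (`shrunk_volume_le_lifeCost`) with the
floor collar `σ` (M5-2d `6·1122^d`, M5-2e `6·collar82 d`) and the lag clause's constant `c` (`1122^d·16·21^d` ∕ `feed82 d`) as PARAMETERS. [folklore] -/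
structure VolumeDisplaysP (C : T4PrintedShapeBanking.Consts) (d K : ℕ) (R : ℕ → ℕ) (u : ℕ → ℝ) (Γ : ℝ) (j : ℕ) (σ c : ℝ) :
    Prop where
  /-- the weight is nonnegative -/
  hu : ∀ n, 0 ≤ u n
  /-- the growth letter is nonnegative -/
  hΓ0 : 0 ≤ Γ
  /-- ONE cumulative growth letter -/
  hΓ : ∀ t n, t ≤ n → u n ≤ Γ * u t
  /-- the lag is at least one -/
  hj1 : 1 ≤ j
  /-- the lag absorbs the feedback, constant `c` -/
  hsmall : c * Γ ≤ 2 ^ j / 2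
  /-- the LAG-FREE floor exchange at the collar `σ` -/
  huS : ∀ t, t ≤ K → u t * σ ≤ floorK C K R t
  /-- the young-birth charge -/
  huE₂ : ∀ n, n ≤ K → u n * (15 * 126 ^ d) ≤ C.E₂ * (R n : ℝ) ^ C.q'
  /-- the size charge -/
  huE₃ : ∀ n, n ≤ K → u n * (24 * 126 ^ d) ≤ C.E₃ * (R n : ℝ) ^ C.q'

/-- **THE GENERIC LAG** `jlag c Γ = max 1 ⌈log₂ ⌈2·(c·Γ)⌉⌉`, the least lag making `hsmall` hold at the constant `c`. [folklore] -/
def jlag (c Γ : ℝ) : ℕ := max 1 (Nat.clog 2 ⌈2 * (c * Γ)⌉₊)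

/-- `1 ≤ jlag c Γ` (`hj1`). [folklore] -/
theorem one_le_jlag (c Γ : ℝ) : 1 ≤ jlag c Γ := le_max_left _ _
/-- **`hsmall` IS AN IDENTITY OF THE GENERIC LAG**: `c·Γ ≤ 2^{jlag c Γ}∕2` (any reals `c`, `Γ`). [folklore] -/
theorem hsmall_jlag (c Γ : ℝ) : c * Γ ≤ 2 ^ jlag c Γ / 2 := by
  have h1 : 2 * (c * Γ) ≤ (⌈2 * (c * Γ)⌉₊ : ℝ) := Nat.le_ceil _
  have h2 : (⌈2 * (c * Γ)⌉₊ : ℝ) ≤ (2 : ℝ) ^ Nat.clog 2 ⌈2 * (c * Γ)⌉₊ := by exact_mod_cast Nat.le_pow_clog one_lt_two _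
  have h3 : (2 : ℝ) ^ Nat.clog 2 ⌈2 * (c * Γ)⌉₊ ≤ 2 ^ jlag c Γ := pow_le_pow_right₀ one_le_two (by unfold jlag; exact le_max_right _ _)
  rw [le_div_iff₀ (by norm_num : (0 : ℝ) < 2)]; linarith

/-- M5-2c∕M5-2d's lag of record IS the generic lag at `c = 1122^d·16·21^d`. [folklore] -/
theorem jvol_eq_jlag (d : ℕ) (Γ : ℝ) : jvol d Γ = jlag ((1122 : ℝ) ^ d * 16 * 21 ^ d) Γ := rfl
variable {C : T4PrintedShapeBanking.Consts} {d K j : ℕ} {R : ℕ → ℕ} {u : ℕ → ℝ} {Γ σ c : ℝ}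

/-- M5-2d's `VolumeDisplaysS` IS the instance `σ = 6·1122^d`, `c = 1122^d·16·21^d` (the field shapes coincide). [folklore] -/
theorem volumeDisplaysP_iff_S :
    VolumeDisplaysP C d K R u Γ j (6 * 1122 ^ d) ((1122 : ℝ) ^ d * 16 * 21 ^ d) ↔ VolumeDisplaysS C d K R u Γ j :=
  ⟨fun h => ⟨h.hu, h.hΓ0, h.hΓ, h.hj1, h.hsmall, h.huS, h.huE₂, h.huE₃⟩, fun h => ⟨h.hu, h.hΓ0, h.hΓ, h.hj1, h.hsmall, h.huS, h.huE₂, h.huE₃⟩⟩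

end Bundle

/-! ## §2 Per cube: `u := uvol cΛ g K`, `Γ := 1 + β₀`, `j := jlag c (1 + β₀)` -/
section PerCube

/-- **THE SHRUNK WINDOW AT THE COLLAR `σ`, PER CUBE** (HYPOTHESIS SHAPE; gaps `1 + κ₂ = r·q′`, `1 + κᵥ = 2p₀`; floor-type clauses at
the letter `cΛ`, (WP1) at the collar `σ`, (WP4) at a displayed WEIGHT `a` — of record `cvol d j Γ` ∕ `cvol82 d j Γ`). [folklore] -/
structure VolumeWindowP (C : T4PrintedShapeBanking.Consts) (d K r κ₂ κᵥ : ℕ) (cΛ θv a σ : ℝ) (g : ℕ → ℝ) : Prop where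
  /-- `1 + κ₂ = r·q′` -/
  expF : 1 + κ₂ = r * C.q'
  /-- `1 + κᵥ = 2p₀` -/
  expV : 1 + κᵥ = 2 * C.p₀
  /-- `ℓ ≥ 1` on the performed range -/
  one_le_ell : ∀ n, n ≤ K → 1 ≤ ell g n
  /-- (WP1), at the collar `σ` -/
  wS : ∀ n, n ≤ K → σ * cΛ ≤ C.E₂ * ell g n ^ κ₂
  /-- (WP2) -/
  wE₂ : ∀ n, n ≤ K → 15 * 126 ^ d * cΛ ≤ C.E₂ * ell g n ^ κ₂
  /-- (WP3) -/
  wE₃ : ∀ n, n ≤ K → 24 * 126 ^ d * cΛ ≤ C.E₃ * ell g n ^ κ₂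
  /-- (WP4), at the weight `a` -/
  wV : ∀ n, n ≤ K → a * cΛ ≤ θv * C.A₀ ^ 2 * ell g n ^ κᵥ

variable {C : T4PrintedShapeBanking.Consts} {d K r κ₂ κᵥ p L : ℕ} {cΛ θv a σ β' β₀ γ : ℝ} {g : ℕ → ℝ} {R : ℕ → ℕ}

/-- **`huθ` PER CUBE** at the window's weight: `a·uvol … n ≤ θᵥ·p₀(g_n)²` for `n ≤ K`. [folklore] -/
theorem huθP_uvol (hW : VolumeWindowP C d K r κ₂ κᵥ cΛ θv a σ g) (n : ℕ) (hn : n ≤ K) :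
    a * uvol cΛ g K n ≤ θv * p0Profile C.A₀ C.p₀ (g n) ^ 2 := by
  rw [uvol_of_le cΛ g hn]; exact coef_mul_letter_le_credit hW.expV (zero_le_one.trans (hW.one_le_ell n hn)) (hW.wV n hn)

/-- **THE BINDERS DISCHARGED PER CUBE, ANY COLLAR** (from (2.7)'s consequence, signs, the lower (2.5) member, the window):
`VolumeDisplaysP C d K R (uvol cΛ g K) (1+β₀) (jlag c (1+β₀)) σ c`, any constant `c`. [folklore] -/
theorem volumeDisplaysP_uvol (hmono : ∀ m n, m < n → n ≤ K → ell g n ≤ (1 + β₀) * ell g m) (hβ₀ : 0 ≤ β₀) (hc : 0 ≤ cΛ)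
    (hE₂ : 0 ≤ C.E₂) (hE₃ : 0 ≤ C.E₃) (hlow : ∀ t, t ≤ K → ell g t ^ r ≤ (R t : ℝ))
    (hW : VolumeWindowP C d K r κ₂ κᵥ cΛ θv a σ g) (c : ℝ) :
    VolumeDisplaysP C d K R (uvol cΛ g K) (1 + β₀) (jlag c (1 + β₀)) σ c where
  hu := uvol_nonneg hc hW.one_le_ell
  hΓ0 := by linarith
  hΓ _ _ htn := uvol_le_of_le hmono hβ₀ hc hW.one_le_ell htn
  hj1 := one_le_jlag c _
  hsmall := hsmall_jlag c _
  huS t ht := by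
    rw [floorK, if_pos ht]
    exact uvol_mul_le_of_clause hW.expF hE₂ ht (zero_le_one.trans (hW.one_le_ell t ht)) (hlow t ht) (hW.wS t ht)
  huE₂ n hn := uvol_mul_le_of_clause hW.expF hE₂ hn (zero_le_one.trans (hW.one_le_ell n hn)) (hlow n hn) (hW.wE₂ n hn)
  huE₃ n hn := uvol_mul_le_of_clause hW.expF hE₃ hn (zero_le_one.trans (hW.one_le_ell n hn)) (hlow n hn) (hW.wE₃ n hn)

/-- the same from (2.7) at any exponent `p ≥ 1` and (2.5) itself. [folklore] -/
theorem volumeDisplaysP_uvol_of_isRj (hp : 1 ≤ p) (h27 : B14.FlowIneq27 g β' β₀ p K) (hβ₀ : 0 ≤ β₀) (hc : 0 ≤ cΛ)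
    (hE₂ : 0 ≤ C.E₂) (hE₃ : 0 ≤ C.E₃) (hRj : ∀ t, t ≤ K → B14.IsRj L r (g t) (R t))
    (hW : VolumeWindowP C d K r κ₂ κᵥ cΛ θv a σ g) (c : ℝ) :
    VolumeDisplaysP C d K R (uvol cΛ g K) (1 + β₀) (jlag c (1 + β₀)) σ c :=
  volumeDisplaysP_uvol
    (fun _ _ hmn hn => ell_later_le_of_flowIneq27 hp h27 hβ₀ (fun j hj => zero_le_one.trans (hW.one_le_ell j hj)) hmn hn)
    hβ₀ hc hE₂ hE₃ (fun t ht => by obtain ⟨_, _, h, _⟩ := hRj t ht; exact h) hW c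

/-- **RECORD-FACING FORM PER CUBE** (cost pinned by `hΛ : log (Λ t) = uvol cΛ g K t`, window kept as a hypothesis). [folklore] -/
theorem volumeDisplaysP_of_log_eq {Λ : ℕ → ℝ} (hΛ : ∀ t, Real.log (Λ t) = uvol cΛ g K t)
    (hmono : ∀ m n, m < n → n ≤ K → ell g n ≤ (1 + β₀) * ell g m) (hβ₀ : 0 ≤ β₀) (hc : 0 ≤ cΛ) (hE₂ : 0 ≤ C.E₂)
    (hE₃ : 0 ≤ C.E₃) (hlow : ∀ t, t ≤ K → ell g t ^ r ≤ (R t : ℝ)) (hW : VolumeWindowP C d K r κ₂ κᵥ cΛ θv a σ g) (c : ℝ) :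
    VolumeDisplaysP C d K R (fun t => Real.log (Λ t)) (1 + β₀) (jlag c (1 + β₀)) σ c := by
  rw [show (fun t => Real.log (Λ t)) = uvol cΛ g K from funext hΛ]; exact volumeDisplaysP_uvol hmono hβ₀ hc hE₂ hE₃ hlow hW c

/-- **`huθ` OVER EVENTS, GUARDED SHAPE** (IR-51-1 (ii) ∕ IR-50-1): for a cost pinned by `hΛ`, over any finite family of events read
through `sh`, `∀ e ∈ E, (sh e).kind = 0 → (sh e).step ≤ K → a·log Λ_{(sh e).step} ≤ θᵥ·p₀(g_{(sh e).step})²`. [folklore] -/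
theorem huθP_events_of_log_eq {ε : Type*} {Λ : ℕ → ℝ} (hΛ : ∀ t, Real.log (Λ t) = uvol cΛ g K t)
    (hW : VolumeWindowP C d K r κ₂ κᵥ cΛ θv a σ g) (sh : ε → PEv) (E : Finset ε) :
    ∀ e ∈ E, (sh e).kind = 0 → (sh e).step ≤ K →
      a * Real.log (Λ (sh e).step) ≤ θv * p0Profile C.A₀ C.p₀ (g (sh e).step) ^ 2 :=
  fun e _ _ hs => by rw [hΛ]; exact huθP_uvol hW _ hs

/-- **THE PER-CUBE THRESHOLD AT THE COLLAR `σ`** (the four clause roots at the letter `cΛ`, and `1`). [folklore] -/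
def ellVolP (C : T4PrintedShapeBanking.Consts) (d κ₂ κᵥ : ℕ) (cΛ θv a σ : ℝ) : ℝ :=
  max 1 (max (max ((σ * cΛ / C.E₂) ^ ((1 : ℝ) / κ₂)) ((15 * 126 ^ d * cΛ / C.E₂) ^ ((1 : ℝ) / κ₂)))
    (max ((24 * 126 ^ d * cΛ / C.E₃) ^ ((1 : ℝ) / κ₂)) ((a * cΛ / (θv * C.A₀ ^ 2)) ^ ((1 : ℝ) / κᵥ))))

/-- **THE PER-CUBE WINDOW FROM ONE THRESHOLD** (`cΛ, a, σ ≥ 0`, gaps `≥ 1`, signs). [folklore] -/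
theorem volumeWindowP_of_threshold (hexpF : 1 + κ₂ = r * C.q') (hexpV : 1 + κᵥ = 2 * C.p₀) (hκ₂ : 1 ≤ κ₂) (hκᵥ : 1 ≤ κᵥ)
    (hc : 0 ≤ cΛ) (hE₂ : 0 < C.E₂) (hE₃ : 0 < C.E₃) (hθ : 0 < θv) (hA₀ : C.A₀ ≠ 0) (ha : 0 ≤ a) (hσ : 0 ≤ σ)
    (hwin : ∀ n, n ≤ K → ellVolP C d κ₂ κᵥ cΛ θv a σ ≤ ell g n) : VolumeWindowP C d K r κ₂ κᵥ cΛ θv a σ g := by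
  have hA2 : 0 < θv * C.A₀ ^ 2 := by positivity
  refine ⟨hexpF, hexpV, fun n hn => ?_, fun n hn => ?_, fun n hn => ?_, fun n hn => ?_, fun n hn => ?_⟩ <;>
    (have h := hwin n hn; simp only [ellVolP, max_le_iff] at h)
  · exact h.1
  · have h' := le_pow_of_rpow_inv_le (div_nonneg (mul_nonneg hσ hc) hE₂.le) hκ₂ h.2.1.1; rw [div_le_iff₀ hE₂] at h'; linarith
  · have h' := le_pow_of_rpow_inv_le (div_nonneg (by positivity) hE₂.le) hκ₂ h.2.1.2; rw [div_le_iff₀ hE₂] at h'; linarith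
  · have h' := le_pow_of_rpow_inv_le (div_nonneg (by positivity) hE₃.le) hκ₂ h.2.2.1; rw [div_le_iff₀ hE₃] at h'; linarith
  · have h' := le_pow_of_rpow_inv_le (div_nonneg (mul_nonneg ha hc) hA2.le) hκᵥ h.2.2.2; rw [div_le_iff₀ hA2] at h'; linarith

/-- **… FROM THE COUPLINGS**: `0 < g_n ≤ γ ≤ e^{−ℓ_P∕2}` on the performed range gives the per-cube window. [folklore] -/
theorem volumeWindowP_of_couplings (hexpF : 1 + κ₂ = r * C.q') (hexpV : 1 + κᵥ = 2 * C.p₀) (hκ₂ : 1 ≤ κ₂) (hκᵥ : 1 ≤ κᵥ)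
    (hc : 0 ≤ cΛ) (hE₂ : 0 < C.E₂) (hE₃ : 0 < C.E₃) (hθ : 0 < θv) (hA₀ : C.A₀ ≠ 0) (ha : 0 ≤ a) (hσ : 0 ≤ σ)
    (hγ : γ ≤ Real.exp (-(ellVolP C d κ₂ κᵥ cΛ θv a σ / 2))) (hg : ∀ n, n ≤ K → 0 < g n ∧ g n ≤ γ) :
    VolumeWindowP C d K r κ₂ κᵥ cΛ θv a σ g :=
  volumeWindowP_of_threshold hexpF hexpV hκ₂ hκᵥ hc hE₂ hE₃ hθ hA₀ ha hσ
    fun n hn => le_ell_of_coupling (hg n hn).1 (hg n hn).2 hγ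

/-- **THE EIGHT BINDERS AT THE COLLAR `σ` FOR A COST PINNED BY `hΛ`, FROM `Flow.InInterval`** (per cube; fed by `h27`, `isRj`, the
prefix at `ellVolP … a σ`; `a, σ ≥ 0`; the record filler). [folklore] -/
theorem volumeDisplaysP_of_log_eq_of_inInterval (Fl : Flow) (hI : Fl.InInterval γ K) {Λ : ℕ → ℝ}
    (hΛ : ∀ t, Real.log (Λ t) = uvol cΛ Fl.g K t) (hexpF : 1 + κ₂ = r * C.q') (hexpV : 1 + κᵥ = 2 * C.p₀) (hκ₂ : 1 ≤ κ₂)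
    (hκᵥ : 1 ≤ κᵥ) (hc : 0 ≤ cΛ) (hE₂ : 0 < C.E₂) (hE₃ : 0 < C.E₃) (hθ : 0 < θv) (hA₀ : C.A₀ ≠ 0) (ha : 0 ≤ a) (hσ : 0 ≤ σ)
    (hβ₀ : 0 ≤ β₀) (hp : 1 ≤ p) (h27 : B14.FlowIneq27 Fl.g β' β₀ p K) (hRj : ∀ t, t ≤ K → B14.IsRj L r (Fl.g t) (R t))
    (hγ : γ ≤ Real.exp (-(ellVolP C d κ₂ κᵥ cΛ θv a σ / 2))) (c : ℝ) :
    VolumeDisplaysP C d K R (fun t => Real.log (Λ t)) (1 + β₀) (jlag c (1 + β₀)) σ c := by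
  rw [show (fun t => Real.log (Λ t)) = uvol cΛ Fl.g K from funext hΛ]
  exact volumeDisplaysP_uvol_of_isRj hp h27 hβ₀ hc hE₂.le hE₃.le hRj
    (volumeWindowP_of_couplings hexpF hexpV hκ₂ hκᵥ hc hE₂ hE₃ hθ hA₀ ha hσ hγ fun n hn => hI n hn) c

/-- **`huθ` OVER EVENTS FROM `Flow.InInterval`, GUARDED SHAPE** (per cube; `a, σ ≥ 0`). [folklore] -/
theorem huθP_events_of_log_eq_of_inInterval (Fl : Flow) (hI : Fl.InInterval γ K) {Λ : ℕ → ℝ}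
    (hΛ : ∀ t, Real.log (Λ t) = uvol cΛ Fl.g K t) (hexpF : 1 + κ₂ = r * C.q') (hexpV : 1 + κᵥ = 2 * C.p₀) (hκ₂ : 1 ≤ κ₂)
    (hκᵥ : 1 ≤ κᵥ) (hc : 0 ≤ cΛ) (hE₂ : 0 < C.E₂) (hE₃ : 0 < C.E₃) (hθ : 0 < θv) (hA₀ : C.A₀ ≠ 0) (ha : 0 ≤ a) (hσ : 0 ≤ σ)
    (hγ : γ ≤ Real.exp (-(ellVolP C d κ₂ κᵥ cΛ θv a σ / 2))) {ε : Type*} (sh : ε → PEv) (E : Finset ε) :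
    ∀ e ∈ E, (sh e).kind = 0 → (sh e).step ≤ K →
      a * Real.log (Λ (sh e).step) ≤ θv * p0Profile C.A₀ C.p₀ (Fl.g (sh e).step) ^ 2 :=
  huθP_events_of_log_eq hΛ (volumeWindowP_of_couplings hexpF hexpV hκ₂ hκᵥ hc hE₂ hE₃ hθ hA₀ ha hσ hγ fun n hn => hI n hn) sh E

/-- **`huθ` AT THE BIRTHS FROM `Flow.InInterval`, WITNESS SHAPE** (per cube): with `hsteps : ∀ e ∈ E, (sh e).kind = 0 → (sh e).step ≤ K`
(e.g. `HistoryBankingVolumeSupply.births_le_of_step_le`) the guard drops — the shape of `HistoryBankingShrunkWitness(82)`'s `huθ` binder and of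
the L-record's `huV` field (IR-48-2's `huV_events_of_log_eq_of_inInterval`). [folklore] -/
theorem huθP_births_of_log_eq_of_inInterval (Fl : Flow) (hI : Fl.InInterval γ K) {Λ : ℕ → ℝ}
    (hΛ : ∀ t, Real.log (Λ t) = uvol cΛ Fl.g K t) (hexpF : 1 + κ₂ = r * C.q') (hexpV : 1 + κᵥ = 2 * C.p₀) (hκ₂ : 1 ≤ κ₂)
    (hκᵥ : 1 ≤ κᵥ) (hc : 0 ≤ cΛ) (hE₂ : 0 < C.E₂) (hE₃ : 0 < C.E₃) (hθ : 0 < θv) (hA₀ : C.A₀ ≠ 0) (ha : 0 ≤ a) (hσ : 0 ≤ σ)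
    (hγ : γ ≤ Real.exp (-(ellVolP C d κ₂ κᵥ cΛ θv a σ / 2))) {ε : Type*} (sh : ε → PEv) (E : Finset ε)
    (hsteps : ∀ e ∈ E, (sh e).kind = 0 → (sh e).step ≤ K) :
    ∀ e ∈ E, (sh e).kind = 0 → a * Real.log (Λ (sh e).step) ≤ θv * p0Profile C.A₀ C.p₀ (Fl.g (sh e).step) ^ 2 :=
  fun e he h0 => huθP_events_of_log_eq_of_inInterval Fl hI hΛ hexpF hexpV hκ₂ hκᵥ hc hE₂ hE₃ hθ hA₀ ha hσ hγ sh E e he h0 (hsteps e he h0)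

end PerCube

/-! ## §3 Lattice units: `u := uvolL cΛ M d g R K`, `Γ := (1+β₀)·L^d`, `j := jlag c ((1+β₀)·L^d)` -/
section Lattice

/-- **THE SHRUNK WINDOW AT THE COLLAR `σ` IN LATTICE UNITS** (HYPOTHESIS SHAPE; gaps `1 + κ₂ = r·(q′ − d)`, `d ≤ q′`, `1 + r·d + κᵥ = 2p₀`;
floor-type clauses at `cΛ·M^d`, (WP1ᴸ) at the collar `σ`, (WP4ᴸ) at the weight `a` and letter `cΛ·(L·M)^d`). [folklore] -/
structure VolumeWindowPL (C : T4PrintedShapeBanking.Consts) (d K r κ₂ κᵥ : ℕ) (cΛ M : ℝ) (L : ℕ) (θv a σ : ℝ) (g : ℕ → ℝ) :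
    Prop where
  /-- `1 + κ₂ = r·(q′ − d)` -/
  expF : 1 + κ₂ = r * (C.q' - d)
  /-- `d ≤ q′` -/
  hdq : d ≤ C.q'
  /-- `1 + r·d + κᵥ = 2p₀` -/
  expV : 1 + r * d + κᵥ = 2 * C.p₀
  /-- `ℓ ≥ 1` on the performed range -/
  one_le_ell : ∀ n, n ≤ K → 1 ≤ ell g n
  /-- (WP1ᴸ), at the collar `σ` -/
  wS : ∀ n, n ≤ K → σ * (cΛ * M ^ d) ≤ C.E₂ * ell g n ^ κ₂
  /-- (WP2ᴸ) -/
  wE₂ : ∀ n, n ≤ K → 15 * 126 ^ d * (cΛ * M ^ d) ≤ C.E₂ * ell g n ^ κ₂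
  /-- (WP3ᴸ) -/
  wE₃ : ∀ n, n ≤ K → 24 * 126 ^ d * (cΛ * M ^ d) ≤ C.E₃ * ell g n ^ κ₂
  /-- (WP4ᴸ), at the weight `a` -/
  wV : ∀ n, n ≤ K → a * (cΛ * (L * M) ^ d) ≤ θv * C.A₀ ^ 2 * ell g n ^ κᵥ

variable {C : T4PrintedShapeBanking.Consts} {d K r κ₂ κᵥ p L : ℕ} {cΛ M θv a σ β' β'' β₀ β₀'' γ : ℝ} {g : ℕ → ℝ} {R : ℕ → ℕ}

/-- **`huθ` IN LATTICE UNITS** (weight `a ≥ 0`, upper (2.5) member, `cΛ, M ≥ 0`): `a·uvolL … n ≤ θᵥ·p₀(g_n)²`, `n ≤ K`. [folklore] -/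
theorem huθPL_uvolL (hW : VolumeWindowPL C d K r κ₂ κᵥ cΛ M L θv a σ g) (hc : 0 ≤ cΛ) (hM : 0 ≤ M) (ha : 0 ≤ a)
    (hup : ∀ n, n ≤ K → (R n : ℝ) ≤ L * ell g n ^ r) (n : ℕ) (hn : n ≤ K) :
    a * uvolL cΛ M d g R K n ≤ θv * p0Profile C.A₀ C.p₀ (g n) ^ 2 := by
  rw [uvolL_of_le cΛ M d g R hn]
  exact coef_mul_letterL_le_credit hW.expV ha hc hM (zero_le_one.trans (hW.one_le_ell n hn)) (hup n hn) (hW.wV n hn)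

/-- **THE BINDERS DISCHARGED IN LATTICE UNITS, ANY COLLAR** (from (2.7)'s and (2.9)'s consequences, signs, `L ≥ 1`, the lower (2.5)
member, the window): `VolumeDisplaysP C d K R (uvolL cΛ M d g R K) ((1+β₀)·L^d) (jlag c ((1+β₀)·L^d)) σ c`. [folklore] -/
theorem volumeDisplaysPL_uvolL (hmono : ∀ m n, m < n → n ≤ K → ell g n ≤ (1 + β₀) * ell g m)
    (hRmono : ∀ m n, m < n → n ≤ K → (R n : ℝ) ≤ L * R m) (hβ₀ : 0 ≤ β₀) (hc : 0 ≤ cΛ) (hM : 0 ≤ M) (hL : 1 ≤ L)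
    (hE₂ : 0 ≤ C.E₂) (hE₃ : 0 ≤ C.E₃) (hlow : ∀ t, t ≤ K → ell g t ^ r ≤ (R t : ℝ))
    (hW : VolumeWindowPL C d K r κ₂ κᵥ cΛ M L θv a σ g) (c : ℝ) :
    VolumeDisplaysP C d K R (uvolL cΛ M d g R K) ((1 + β₀) * L ^ d) (jlag c ((1 + β₀) * L ^ d)) σ c where
  hu := uvolL_nonneg hc hM hW.one_le_ell
  hΓ0 := by positivity
  hΓ _ _ htn := uvolL_le_of_le hmono hRmono hβ₀ hc hM hL hW.one_le_ell htn
  hj1 := one_le_jlag c _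
  hsmall := hsmall_jlag c _
  huS t ht := by
    rw [floorK, if_pos ht]
    exact uvolL_mul_le_of_clause hW.expF hW.hdq hE₂ ht (zero_le_one.trans (hW.one_le_ell t ht)) (hlow t ht) (hW.wS t ht)
  huE₂ n hn := uvolL_mul_le_of_clause hW.expF hW.hdq hE₂ hn (zero_le_one.trans (hW.one_le_ell n hn)) (hlow n hn) (hW.wE₂ n hn)
  huE₃ n hn := uvolL_mul_le_of_clause hW.expF hW.hdq hE₃ hn (zero_le_one.trans (hW.one_le_ell n hn)) (hlow n hn) (hW.wE₃ n hn)

/-- the same from (2.7) at any exponent `p ≥ 1`, (2.9) and (2.5) itself. [folklore] -/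
theorem volumeDisplaysPL_uvolL_of_isRj (hp : 1 ≤ p) (h27 : B14.FlowIneq27 g β' β₀ p K)
    (h29 : B14FlowStep.FlowIneq29 R g L β'' β₀'' K) (hβ₀ : 0 ≤ β₀) (hc : 0 ≤ cΛ) (hM : 0 ≤ M) (hL : 1 ≤ L) (hE₂ : 0 ≤ C.E₂)
    (hE₃ : 0 ≤ C.E₃) (hRj : ∀ t, t ≤ K → B14.IsRj L r (g t) (R t)) (hW : VolumeWindowPL C d K r κ₂ κᵥ cΛ M L θv a σ g)
    (c : ℝ) : VolumeDisplaysP C d K R (uvolL cΛ M d g R K) ((1 + β₀) * L ^ d) (jlag c ((1 + β₀) * L ^ d)) σ c :=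
  volumeDisplaysPL_uvolL
    (fun _ _ hmn hn => ell_later_le_of_flowIneq27 hp h27 hβ₀ (fun j hj => zero_le_one.trans (hW.one_le_ell j hj)) hmn hn)
    (fun _ _ hmn hn => (h29 _ _ hmn hn).1) hβ₀ hc hM hL hE₂ hE₃ (fun t ht => by obtain ⟨_, _, h, _⟩ := hRj t ht; exact h) hW c

/-- **RECORD-FACING FORM IN LATTICE UNITS** (cost pinned by `hΛ : log (Λ t) = uvolL cΛ M d g R K t`). [folklore] -/
theorem volumeDisplaysPL_of_log_eq {Λ : ℕ → ℝ} (hΛ : ∀ t, Real.log (Λ t) = uvolL cΛ M d g R K t)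
    (hmono : ∀ m n, m < n → n ≤ K → ell g n ≤ (1 + β₀) * ell g m)
    (hRmono : ∀ m n, m < n → n ≤ K → (R n : ℝ) ≤ L * R m) (hβ₀ : 0 ≤ β₀) (hc : 0 ≤ cΛ) (hM : 0 ≤ M) (hL : 1 ≤ L)
    (hE₂ : 0 ≤ C.E₂) (hE₃ : 0 ≤ C.E₃) (hlow : ∀ t, t ≤ K → ell g t ^ r ≤ (R t : ℝ))
    (hW : VolumeWindowPL C d K r κ₂ κᵥ cΛ M L θv a σ g) (c : ℝ) :
    VolumeDisplaysP C d K R (fun t => Real.log (Λ t)) ((1 + β₀) * L ^ d) (jlag c ((1 + β₀) * L ^ d)) σ c := by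
  rw [show (fun t => Real.log (Λ t)) = uvolL cΛ M d g R K from funext hΛ]
  exact volumeDisplaysPL_uvolL hmono hRmono hβ₀ hc hM hL hE₂ hE₃ hlow hW c

/-- **`huθ` OVER EVENTS IN LATTICE UNITS, GUARDED SHAPE** for a cost pinned by `hΛ` (weight `a ≥ 0`; upper (2.5) member `hup`). [folklore] -/
theorem huθPL_events_of_log_eq {ε : Type*} {Λ : ℕ → ℝ} (hΛ : ∀ t, Real.log (Λ t) = uvolL cΛ M d g R K t)
    (hW : VolumeWindowPL C d K r κ₂ κᵥ cΛ M L θv a σ g) (hc : 0 ≤ cΛ) (hM : 0 ≤ M) (ha : 0 ≤ a)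
    (hup : ∀ n, n ≤ K → (R n : ℝ) ≤ L * ell g n ^ r) (sh : ε → PEv) (E : Finset ε) :
    ∀ e ∈ E, (sh e).kind = 0 → (sh e).step ≤ K →
      a * Real.log (Λ (sh e).step) ≤ θv * p0Profile C.A₀ C.p₀ (g (sh e).step) ^ 2 :=
  fun e _ _ hs => by rw [hΛ]; exact huθPL_uvolL hW hc hM ha hup _ hs

/-- **THE LATTICE THRESHOLD AT THE COLLAR `σ`** (the four clause roots at `cΛM^d` ∕ `cΛ(LM)^d`, and `1`). [folklore] -/
def ellVolPL (C : T4PrintedShapeBanking.Consts) (d κ₂ κᵥ : ℕ) (cΛ M : ℝ) (L : ℕ) (θv a σ : ℝ) : ℝ :=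
  max 1 (max (max ((σ * (cΛ * M ^ d) / C.E₂) ^ ((1 : ℝ) / κ₂)) ((15 * 126 ^ d * (cΛ * M ^ d) / C.E₂) ^ ((1 : ℝ) / κ₂)))
    (max ((24 * 126 ^ d * (cΛ * M ^ d) / C.E₃) ^ ((1 : ℝ) / κ₂))
      ((a * (cΛ * (L * M) ^ d) / (θv * C.A₀ ^ 2)) ^ ((1 : ℝ) / κᵥ))))

/-- **THE LATTICE WINDOW FROM ONE THRESHOLD** (`cΛ, M, a, σ ≥ 0`, gaps `≥ 1`, signs). [folklore] -/
theorem volumeWindowPL_of_threshold (hexpF : 1 + κ₂ = r * (C.q' - d)) (hdq : d ≤ C.q') (hexpV : 1 + r * d + κᵥ = 2 * C.p₀)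
    (hκ₂ : 1 ≤ κ₂) (hκᵥ : 1 ≤ κᵥ) (hc : 0 ≤ cΛ) (hM : 0 ≤ M) (hE₂ : 0 < C.E₂) (hE₃ : 0 < C.E₃) (hθ : 0 < θv) (hA₀ : C.A₀ ≠ 0)
    (ha : 0 ≤ a) (hσ : 0 ≤ σ) (hwin : ∀ n, n ≤ K → ellVolPL C d κ₂ κᵥ cΛ M L θv a σ ≤ ell g n) :
    VolumeWindowPL C d K r κ₂ κᵥ cΛ M L θv a σ g := by
  have hA2 : 0 < θv * C.A₀ ^ 2 := by positivity
  have hcM : 0 ≤ cΛ * M ^ d := mul_nonneg hc (pow_nonneg hM _)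
  have hcv : 0 ≤ a * (cΛ * (L * M) ^ d) := mul_nonneg ha (mul_nonneg hc (pow_nonneg (mul_nonneg (Nat.cast_nonneg _) hM) _))
  refine ⟨hexpF, hdq, hexpV, fun n hn => ?_, fun n hn => ?_, fun n hn => ?_, fun n hn => ?_, fun n hn => ?_⟩ <;>
    (have h := hwin n hn; simp only [ellVolPL, max_le_iff] at h)
  · exact h.1
  · have h' := le_pow_of_rpow_inv_le (div_nonneg (mul_nonneg hσ hcM) hE₂.le) hκ₂ h.2.1.1; rw [div_le_iff₀ hE₂] at h'; linarith
  · have h' := le_pow_of_rpow_inv_le (div_nonneg (by positivity) hE₂.le) hκ₂ h.2.1.2; rw [div_le_iff₀ hE₂] at h'; linarith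
  · have h' := le_pow_of_rpow_inv_le (div_nonneg (by positivity) hE₃.le) hκ₂ h.2.2.1; rw [div_le_iff₀ hE₃] at h'; linarith
  · have h' := le_pow_of_rpow_inv_le (div_nonneg hcv hA2.le) hκᵥ h.2.2.2; rw [div_le_iff₀ hA2] at h'; linarith

/-- **… FROM THE COUPLINGS** (`0 < g_n ≤ γ ≤ e^{−ℓ_Pᴸ∕2}` on the performed range). [folklore] -/
theorem volumeWindowPL_of_couplings (hexpF : 1 + κ₂ = r * (C.q' - d)) (hdq : d ≤ C.q') (hexpV : 1 + r * d + κᵥ = 2 * C.p₀)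
    (hκ₂ : 1 ≤ κ₂) (hκᵥ : 1 ≤ κᵥ) (hc : 0 ≤ cΛ) (hM : 0 ≤ M) (hE₂ : 0 < C.E₂) (hE₃ : 0 < C.E₃) (hθ : 0 < θv) (hA₀ : C.A₀ ≠ 0)
    (ha : 0 ≤ a) (hσ : 0 ≤ σ) (hγ : γ ≤ Real.exp (-(ellVolPL C d κ₂ κᵥ cΛ M L θv a σ / 2)))
    (hg : ∀ n, n ≤ K → 0 < g n ∧ g n ≤ γ) : VolumeWindowPL C d K r κ₂ κᵥ cΛ M L θv a σ g :=
  volumeWindowPL_of_threshold hexpF hdq hexpV hκ₂ hκᵥ hc hM hE₂ hE₃ hθ hA₀ ha hσ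
    fun n hn => le_ell_of_coupling (hg n hn).1 (hg n hn).2 hγ

/-- **THE EIGHT BINDERS AT THE COLLAR `σ` FOR A COST PINNED BY `hΛL`, FROM `Flow.InInterval`** (lattice; fed by `h27`, `h29`, `isRj`,
the prefix at `ellVolPL … a σ`; `a, σ ≥ 0`; any constant `c`). [folklore] -/
theorem volumeDisplaysPL_of_log_eq_of_inInterval (Fl : Flow) (hI : Fl.InInterval γ K) {Λ : ℕ → ℝ}
    (hΛ : ∀ t, Real.log (Λ t) = uvolL cΛ M d Fl.g R K t) (hexpF : 1 + κ₂ = r * (C.q' - d)) (hdq : d ≤ C.q')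
    (hexpV : 1 + r * d + κᵥ = 2 * C.p₀) (hκ₂ : 1 ≤ κ₂) (hκᵥ : 1 ≤ κᵥ) (hc : 0 ≤ cΛ) (hM : 0 ≤ M) (hL : 1 ≤ L)
    (hE₂ : 0 < C.E₂) (hE₃ : 0 < C.E₃) (hθ : 0 < θv) (hA₀ : C.A₀ ≠ 0) (ha : 0 ≤ a) (hσ : 0 ≤ σ) (hβ₀ : 0 ≤ β₀) (hp : 1 ≤ p)
    (h27 : B14.FlowIneq27 Fl.g β' β₀ p K) (h29 : B14FlowStep.FlowIneq29 R Fl.g L β'' β₀'' K)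
    (hRj : ∀ t, t ≤ K → B14.IsRj L r (Fl.g t) (R t)) (hγ : γ ≤ Real.exp (-(ellVolPL C d κ₂ κᵥ cΛ M L θv a σ / 2)))
    (c : ℝ) : VolumeDisplaysP C d K R (fun t => Real.log (Λ t)) ((1 + β₀) * L ^ d) (jlag c ((1 + β₀) * L ^ d)) σ c := by
  rw [show (fun t => Real.log (Λ t)) = uvolL cΛ M d Fl.g R K from funext hΛ]
  exact volumeDisplaysPL_uvolL_of_isRj hp h27 h29 hβ₀ hc hM hL hE₂.le hE₃.le hRj
    (volumeWindowPL_of_couplings hexpF hdq hexpV hκ₂ hκᵥ hc hM hE₂ hE₃ hθ hA₀ ha hσ hγ fun n hn => hI n hn) c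

/-- **`huθ` OVER EVENTS FROM `Flow.InInterval` IN LATTICE UNITS, GUARDED SHAPE** (`a, σ ≥ 0`; upper member from `isRj`, `L ≥ 1`). [folklore] -/
theorem huθPL_events_of_log_eq_of_inInterval (Fl : Flow) (hI : Fl.InInterval γ K) {Λ : ℕ → ℝ}
    (hΛ : ∀ t, Real.log (Λ t) = uvolL cΛ M d Fl.g R K t) (hexpF : 1 + κ₂ = r * (C.q' - d)) (hdq : d ≤ C.q')
    (hexpV : 1 + r * d + κᵥ = 2 * C.p₀) (hκ₂ : 1 ≤ κ₂) (hκᵥ : 1 ≤ κᵥ) (hc : 0 ≤ cΛ) (hM : 0 ≤ M) (hL : 1 ≤ L)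
    (hE₂ : 0 < C.E₂) (hE₃ : 0 < C.E₃) (hθ : 0 < θv) (hA₀ : C.A₀ ≠ 0) (ha : 0 ≤ a) (hσ : 0 ≤ σ)
    (hRj : ∀ t, t ≤ K → B14.IsRj L r (Fl.g t) (R t)) (hγ : γ ≤ Real.exp (-(ellVolPL C d κ₂ κᵥ cΛ M L θv a σ / 2)))
    {ε : Type*} (sh : ε → PEv) (E : Finset ε) :
    ∀ e ∈ E, (sh e).kind = 0 → (sh e).step ≤ K → a * Real.log (Λ (sh e).step) ≤ θv * p0Profile C.A₀ C.p₀ (Fl.g (sh e).step) ^ 2 :=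
  have hW := volumeWindowPL_of_couplings hexpF hdq hexpV hκ₂ hκᵥ hc hM hE₂ hE₃ hθ hA₀ ha hσ hγ fun n hn => hI n hn
  huθPL_events_of_log_eq hΛ hW hc hM ha (fun t ht => (envelope_of_isRj hL (hRj t ht) (hW.one_le_ell t ht)).1) sh E

/-- **`huθ` AT THE BIRTHS FROM `Flow.InInterval` IN LATTICE UNITS, WITNESS SHAPE** (`hsteps` drops the guard). [folklore] -/
theorem huθPL_births_of_log_eq_of_inInterval (Fl : Flow) (hI : Fl.InInterval γ K) {Λ : ℕ → ℝ}
    (hΛ : ∀ t, Real.log (Λ t) = uvolL cΛ M d Fl.g R K t) (hexpF : 1 + κ₂ = r * (C.q' - d)) (hdq : d ≤ C.q')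
    (hexpV : 1 + r * d + κᵥ = 2 * C.p₀) (hκ₂ : 1 ≤ κ₂) (hκᵥ : 1 ≤ κᵥ) (hc : 0 ≤ cΛ) (hM : 0 ≤ M) (hL : 1 ≤ L)
    (hE₂ : 0 < C.E₂) (hE₃ : 0 < C.E₃) (hθ : 0 < θv) (hA₀ : C.A₀ ≠ 0) (ha : 0 ≤ a) (hσ : 0 ≤ σ)
    (hRj : ∀ t, t ≤ K → B14.IsRj L r (Fl.g t) (R t)) (hγ : γ ≤ Real.exp (-(ellVolPL C d κ₂ κᵥ cΛ M L θv a σ / 2)))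
    {ε : Type*} (sh : ε → PEv) (E : Finset ε) (hsteps : ∀ e ∈ E, (sh e).kind = 0 → (sh e).step ≤ K) :
    ∀ e ∈ E, (sh e).kind = 0 → a * Real.log (Λ (sh e).step) ≤ θv * p0Profile C.A₀ C.p₀ (Fl.g (sh e).step) ^ 2 :=
  fun e he h0 => huθPL_events_of_log_eq_of_inInterval Fl hI hΛ hexpF hdq hexpV hκ₂ hκᵥ hc hM hL hE₂ hE₃ hθ hA₀ ha hσ hRj hγ sh E e he
    h0 (hsteps e he h0)

end Lattice

end

end Summit.QuantumFields.BalabanUV.T4Continuum.HistoryBankingVolumeWindowCollar
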